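import Summits.AnomalousDissipation.AnomalousDissipation.Theorems.BaireTransferRobustLoudUpgradeLine
import Literature.Analysis.FluidPDE.SteadyNSLatticePersistenceDrift
import Literature.Analysis.FluidPDE.KolmogorovShearLinearised
import Literature.Analysis.FluidPDE.PoincareBall

/-!
# Stub `stub_smallFlowNondeg` of the line `malkin-cone-group-orbits` (crux stmt-AnomalousDissipation-1144,
# companion lead c1): small smooth flows are linearly nondegenerate in the mean-zero class

Registered stub (Pi-form, no new vocabulary): there is `κ > 0` such that every smooth divergence-free field
`v` on `T³` — of ANY mean — with `‖Δv‖_{L²} ≤ κ ν` has NO non-trivial mean-zero classical kernel field of its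
Navier–Stokes linearisation `L(ν,v) w = νΔw − (v·∇)w − (w·∇)v − ∇q`
(`¬ Torus.IsLinNSEigenvalue ν v 0`, vocabulary of `Literature/Analysis/FluidPDE/LinearizedNSTorus.lean`).

Proof (lattice coercivity; Temam 1979, Ch. II §1, (1.29)–(1.31), in Fourier variables).  Let `w ≠ 0` be such
a kernel field, `ĉ = 𝓕w` (rapidly decaying, transversal, `ĉ(0) = 0`), `â = 𝓕(complexify ∘ v)`.
* §2 `KolmogorovShear.fourier_eq_of_linearizedNSOperator_eq_zero` gives the equation componentwise; the Leray
  symbol kills the pressure: `ν4π²|k|² ĉ(k) + Π_k (N(â,ĉ) + N(ĉ,â))(k) = 0` (`leray_linearised_eq`).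
* §2 The zero mode `M = â(0)` (the complexified mean, a real vector) only DRIFTS: splitting
  `â = â° + δ₀ M` (`SteadyLatticeDrift.nl_linearised_add_single`) gives
  `(ν4π²|k|² + 2πi (k·M)) ĉ(k) = −Π_k N(â°,ĉ)(k) − Π_k N(ĉ,â°)(k)`, and the scalar on the left has modulus
  `≥ ν4π²|k|²` (its real part).
* §3 With the weighted unknowns `x(k) = |k|² ĉ(k)`, `x_b(k) = |k|² â(k)` (so `ĉ = cf x`, `â° = cf x_b`),
  squaring and summing in `ℝ≥0∞` with `SteadyLattice.tsum_enorm_sq_leray_nl_cf_le` (Young + Cauchy–Schwarz,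
  `Z = ∑_{m≠0} |m|⁻⁴ < ∞`) yields `(4π²ν)² X ≤ 4 (36π)² Z ‖x_b‖² X`, `X = ∑‖x(k)‖²` finite; Parseval turns
  `‖x_b‖²` into `‖Δv‖₂²/(4π²)² ≤ κ²ν²/(4π²)²`, and for `κ = 1/(Z+1)` the factor is `< (4π²ν)²`, forcing `X = 0`,
  `ĉ = 0`, `w = 0` (Fourier uniqueness) — a contradiction.

Templates: `Literature/Analysis/FluidPDE/KolmogorovShearLinearised.lean` (classical kernel → Fourier side),
`Literature/Analysis/FluidPDE/SteadyNSLatticePersistence.lean` §C, §E, §K, §M and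
`Literature/Analysis/FluidPDE/SteadyNSLatticePersistenceDrift.lean` §A (drift bookkeeping).

References: R. Temam, *Navier–Stokes Equations* (1979), Ch. II §1 (Thm. 1.3: uniqueness / regular points of
the steady map below the first Grashof threshold); P. Constantin, C. Foias, *Navier–Stokes Equations* (1988),
Ch. 7, 10.
-/

-- `Summit.<Summit>.<Problem>` is the tree's mandated summit-side namespace (CONVENTIONS §2); for this
-- single-conjunct summit the two coincide, so the duplicate is deliberate.
set_option linter.dupNamespace false

noncomputable section

open scoped BigOperators Topology ENNReal NNReal ComplexConjugate
open Filter Set Function TopologicalSpace MeasureTheory UnitAddTorus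

namespace Summit.AnomalousDissipation.AnomalousDissipation.Theorems.RobustLoudUpgrade.LaminarCorner

open Literature.Analysis.FunctionSpaces Literature.Analysis.FunctionSpaces.Torus
open Literature.Analysis.FunctionSpaces.EuclideanSpace
open Literature.Analysis.FluidPDE
open Literature.Analysis.FluidPDE.ScalarFourier
open Literature.Analysis.FluidPDE.SteadyLattice
open Summit.AnomalousDissipation.AnomalousDissipation.Theorems.RobustLoudUpgrade

/-! ## §1 Scalar and `ℝ≥0∞` trivia -/

section Trivia

/-- **Square-summing a pointwise bound**: if `r X(k) ≤ A(k) + B(k)` for all `k` and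
`∑ A² ≤ R`, `∑ B² ≤ R`, then `r² ∑ X² ≤ 4 R` (in `ℝ≥0∞`; `(A + B)² ≤ 2A² + 2B²` is
`PoincareBall.add_sq_le_two_mul_sq_add`). [folklore] -/
theorem sq_mul_tsum_le_of_pointwise {ι : Type*} {A B X : ι → ℝ≥0∞} {r R : ℝ≥0∞}
    (hpt : ∀ k, r * X k ≤ A k + B k) (hA : ∑' k, A k ^ 2 ≤ R) (hB : ∑' k, B k ^ 2 ≤ R) :
    r ^ 2 * ∑' k, X k ^ 2 ≤ 4 * R := by
  calc r ^ 2 * ∑' k, X k ^ 2 = ∑' k, (r * X k) ^ 2 := by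
        rw [← ENNReal.tsum_mul_left]
        exact tsum_congr fun k => by ring
    _ ≤ ∑' k, (2 * A k ^ 2 + 2 * B k ^ 2) :=
        ENNReal.tsum_le_tsum fun k =>
          (pow_le_pow_left' (hpt k) 2).trans (PoincareBall.add_sq_le_two_mul_sq_add _ _)
    _ = 2 * ∑' k, A k ^ 2 + 2 * ∑' k, B k ^ 2 := by
        rw [ENNReal.tsum_add, ENNReal.tsum_mul_left, ENNReal.tsum_mul_left]
    _ ≤ 2 * R + 2 * R := by gcongr
    _ = 4 * R := by ring

/-- `‖(r : ℂ)‖ₑ = ofReal r` for `0 ≤ r`. [folklore] -/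
theorem enorm_ofReal_of_nonneg {r : ℝ} (hr : 0 ≤ r) : ‖((r : ℝ) : ℂ)‖ₑ = ENNReal.ofReal r := by
  rw [← ofReal_norm, Complex.norm_real, Real.norm_of_nonneg hr]

/-- The real part of a scalar bounds the norm of its action from below: `Re s · ‖u‖ ≤ ‖s • u‖`. [folklore] -/
theorem re_mul_norm_le_norm_smul (s : ℂ) (u : EuclideanSpace ℂ (Fin 3)) : s.re * ‖u‖ ≤ ‖s • u‖ := by
  rw [norm_smul]
  exact mul_le_mul_of_nonneg_right (Complex.re_le_norm s) (norm_nonneg _)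

/-- **The drift coefficient is purely imaginary**: `Re (2πi (k·M)) = 0` for a real vector `M`
(`conj M = M`). [folklore] -/
theorem driftCoeff_re {M : EuclideanSpace ℂ (Fin 3)} (hM : conjVec M = M) (k : Fin 3 → ℤ) :
    (2 * Real.pi * Complex.I * (∑ jj : Fin 3, ((k jj : ℤ) : ℂ) * M jj) : ℂ).re = 0 := by
  have him : (∑ jj : Fin 3, ((k jj : ℤ) : ℂ) * M jj).im = 0 := by
    refine Complex.conj_eq_iff_im.1 ?_
    rw [SteadyLatticeDrift.conj_kdot, hM]
  simp [Complex.mul_re, Complex.mul_im, him]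

/-- **The final arithmetic**: with `κ = 1/(z+1)`, `D ≤ (κν)²` is incompatible with
`(4π²ν)² ≤ 4 (36π)² z ((4π²)⁻² D)` (since `π² > 9`). [folklore] -/
theorem laminar_arith_contra {z D ν : ℝ} (hz : 0 ≤ z) (hν : 0 < ν) (hD : D ≤ ((z + 1)⁻¹ * ν) ^ 2)
    (h : (4 * Real.pi ^ 2 * ν) ^ 2 ≤ 4 * (36 * Real.pi) ^ 2 * z * ((4 * Real.pi ^ 2)⁻¹ ^ 2 * D)) : False := by
  have hπ3 := Real.pi_gt_three
  set P : ℝ := Real.pi ^ 2 with hP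
  have hP9 : 9 < P := by rw [hP]; nlinarith
  have hP0 : 0 < P := by linarith
  have hP3 : (729 : ℝ) < P ^ 3 := by
    calc (729 : ℝ) = 9 ^ 3 := by norm_num
      _ < P ^ 3 := by gcongr
  -- `z D ≤ ν²`
  have hzD : z * D ≤ ν ^ 2 := by
    have h1 : z * D ≤ z * ((z + 1)⁻¹ * ν) ^ 2 := mul_le_mul_of_nonneg_left hD hz
    have h2 : z * ((z + 1)⁻¹ * ν) ^ 2 = (z / (z + 1) ^ 2) * ν ^ 2 := by
      field_simp
    have h3 : z / (z + 1) ^ 2 ≤ 1 := by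
      rw [div_le_one (by positivity)]; nlinarith
    calc z * D ≤ (z / (z + 1) ^ 2) * ν ^ 2 := h1.trans h2.le
      _ ≤ 1 * ν ^ 2 := mul_le_mul_of_nonneg_right h3 (sq_nonneg ν)
      _ = ν ^ 2 := one_mul _
  -- rewrite the main inequality as `16 P³ ν² ≤ 324 z D`
  have e1 : (4 * Real.pi ^ 2 * ν) ^ 2 = 16 * P ^ 2 * ν ^ 2 := by rw [hP]; ring
  have e2 : 4 * (36 * Real.pi) ^ 2 * z * ((4 * Real.pi ^ 2)⁻¹ ^ 2 * D) = 324 * (z * D) / P := by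
    rw [hP]; field_simp; ring
  rw [e1, e2, le_div_iff₀ hP0] at h
  have h4 : 16 * P ^ 3 * ν ^ 2 ≤ 324 * ν ^ 2 := by nlinarith
  nlinarith [mul_lt_mul_of_pos_right hP3 (pow_pos hν 2)]

end Trivia

/-! ## §2 The kernel equation on the Fourier lattice -/

section Lattice

/-- **A classical kernel pair `L(ν,v)(w,q) = 0` solves the Leray-projected lattice equation**
`ν4π²|k|² ŵ(k) + Π_k (N(V̂,ŵ) + N(ŵ,V̂))(k) = 0`, `V̂ = 𝓕(complexify ∘ v)` the FULL family (any mean):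
componentwise `KolmogorovShear.fourier_eq_of_linearizedNSOperator_eq_zero`, then the Leray symbol kills the
pressure gradient `2πi q̂(k) k` and fixes the transversal `ŵ(k)` (pattern of
`SteadyLattice.fourier_eq_of_isSteadyNSState`). [folklore] -/
theorem leray_linearised_eq {ν : ℝ} {v : UnitAddTorus (Fin 3) → EuclideanSpace ℝ (Fin 3)} (hv : IsSmooth v)
    {w : UnitAddTorus (Fin 3) → EuclideanSpace ℂ (Fin 3)} {q : UnitAddTorus (Fin 3) → ℂ} (hw : IsSmooth w)
    (hdiv : Torus.IsDivFreeC w) (h0 : HasZeroMean w) (hq : IsSmooth q)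
    (hE : ∀ x, Torus.linearizedNSOperator ν v w q x = 0) (k : Fin 3 → ℤ) :
    (((ν * (4 * Real.pi ^ 2 * freqNormSq k)) : ℝ) : ℂ) • mFourierCoeff w k +
      Torus.lerayCoeff k
        ((WithLp.toLp 2 (fun pp : Fin 3 => transportSym (fun jj mm => mFourierCoeff (complexify ∘ v) mm jj)
            (fun mm => mFourierCoeff w mm pp) k) : EuclideanSpace ℂ (Fin 3)) +
          (WithLp.toLp 2 (fun pp : Fin 3 => transportSym (fun jj mm => mFourierCoeff w mm jj)
            (fun mm => mFourierCoeff (complexify ∘ v) mm pp) k) : EuclideanSpace ℂ (Fin 3))) = 0 := by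
  -- the unprojected identity `ν4π²|k|² ŵ + N(V̂,ŵ) + N(ŵ,V̂) + (2πi q̂) k = 0`
  have hV : (((ν * (4 * Real.pi ^ 2 * freqNormSq k)) : ℝ) : ℂ) • mFourierCoeff w k +
      ((WithLp.toLp 2 (fun pp : Fin 3 => transportSym (fun jj mm => mFourierCoeff (complexify ∘ v) mm jj)
            (fun mm => mFourierCoeff w mm pp) k) : EuclideanSpace ℂ (Fin 3)) +
          (WithLp.toLp 2 (fun pp : Fin 3 => transportSym (fun jj mm => mFourierCoeff w mm jj)
            (fun mm => mFourierCoeff (complexify ∘ v) mm pp) k) : EuclideanSpace ℂ (Fin 3))) +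
      (2 * Real.pi * Complex.I * mFourierCoeff q k) • Torus.freqVec k = 0 := by
    ext p
    have h := KolmogorovShear.fourier_eq_of_linearizedNSOperator_eq_zero hv hw hq hE k p
    simp only [PiLp.add_apply, PiLp.smul_apply, PiLp.zero_apply, smul_eq_mul, Torus.freqVec_apply]
    linear_combination -h
  by_cases hk0 : k = 0
  · subst hk0
    rw [Torus.lerayCoeff_zero, add_zero, mFourierCoeff_zero_of_hasZeroMean h0, smul_zero]
  · have e1 := lerayCoeff_of_kdot_eq_zero hk0 (KolmogorovShear.kdot_mFourierCoeff_eq_zero hw hdiv k)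
    have h' := congrArg (Torus.lerayCoeff k) hV
    rw [lerayCoeff_zero_vec, lerayCoeff_add', lerayCoeff_add', lerayCoeff_smul', lerayCoeff_smul', e1,
      lerayCoeff_freqVec, smul_zero, add_zero] at h'
    exact h'

/-- **Splitting off the drift of the zero mode**: for rapidly decaying `a`, `c` with `Π_k c(k) = c(k)`,
`Π_k (N(a,c) + N(c,a))(k) = Π_k N(a°,c)(k) + Π_k N(c,a°)(k) + 2πi (k·a(0)) c(k)`, `a° = a − δ₀ a(0)`
(`SteadyLatticeDrift.nl_linearised_add_single`: `N(δ₀M, c)(k) = 2πi (k·M) c(k)`, `N(c, δ₀M) = 0`). [folklore] -/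
theorem leray_split_drift {a c : (Fin 3 → ℤ) → EuclideanSpace ℂ (Fin 3)} (ha : RapidDecay a) (hc : RapidDecay c)
    (hPc : ∀ k, Torus.lerayCoeff k (c k) = c k) (k : Fin 3 → ℤ) :
    Torus.lerayCoeff k
        ((WithLp.toLp 2 (fun pp : Fin 3 => transportSym (fun jj mm => a mm jj) (fun mm => c mm pp) k) :
            EuclideanSpace ℂ (Fin 3)) +
          (WithLp.toLp 2 (fun pp : Fin 3 => transportSym (fun jj mm => c mm jj) (fun mm => a mm pp) k) :
            EuclideanSpace ℂ (Fin 3))) =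
      Torus.lerayCoeff k ((WithLp.toLp 2 (fun pp : Fin 3 => transportSym
          (fun jj mm => (Function.update a 0 0) mm jj) (fun mm => c mm pp) k) : EuclideanSpace ℂ (Fin 3))) +
        Torus.lerayCoeff k ((WithLp.toLp 2 (fun pp : Fin 3 => transportSym (fun jj mm => c mm jj)
          (fun mm => (Function.update a 0 0) mm pp) k) : EuclideanSpace ℂ (Fin 3))) +
        (2 * Real.pi * Complex.I * (∑ jj : Fin 3, ((k jj : ℤ) : ℂ) * (a 0) jj)) • c k := by
  have hb : RapidDecay (Function.update a 0 0) := SteadyLatticeDrift.rapidDecay_update ha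
  conv_lhs => rw [← SteadyLatticeDrift.update_add_single a]
  rw [SteadyLatticeDrift.nl_linearised_add_single (a 0) k (fun j p => summable_nl_rapid hb hc k j p)
      (fun j p => summable_nl_rapid hc hb k j p), lerayCoeff_add', lerayCoeff_add', lerayCoeff_smul', hPc]

/-- **Parseval for the weighted family `|k|² â(k)`**: `∑_k ‖|k|² 𝓕(complexify ∘ v)(k)‖² = ‖Δv‖₂²/(4π²)²`
(`𝓕(complexify ∘ Δv)(k) = −4π²|k|² 𝓕(complexify ∘ v)(k)` and Parseval for the continuous field `Δv`). [folklore] -/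
theorem tsum_enorm_sq_weight_coeff {v : UnitAddTorus (Fin 3) → EuclideanSpace ℝ (Fin 3)} (hv : IsSmooth v) :
    ∑' k : Fin 3 → ℤ, ‖((freqNormSq k : ℝ) : ℂ) • mFourierCoeff (complexify ∘ v) k‖ₑ ^ 2 =
      ENNReal.ofReal ((4 * Real.pi ^ 2)⁻¹) ^ 2 * ENNReal.ofReal (∫ x, ‖laplacian v x‖ ^ 2) := by
  have hpar := tsum_enorm_sq_mFourierCoeff_euclidean (hv.laplacian.complexify_comp).continuous
  have hn : ∀ x, ‖(complexify ∘ laplacian v) x‖ = ‖laplacian v x‖ := fun x => by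
    rw [Function.comp_apply, norm_complexify]
  simp_rw [hn] at hpar
  rw [← hpar, ← ENNReal.tsum_mul_left]
  refine tsum_congr fun k => ?_
  have hpi : (0 : ℝ) ≤ (4 * Real.pi ^ 2)⁻¹ := by positivity
  have h4 : (0 : ℝ) ≤ 4 * Real.pi ^ 2 * freqNormSq k := mul_nonneg (by positivity) (freqNormSq_nonneg k)
  rw [mFourierCoeff_complexify_laplacian hv k, enorm_neg, enorm_smul, enorm_smul,
    enorm_ofReal_of_nonneg (freqNormSq_nonneg k), enorm_ofReal_of_nonneg h4, ← mul_pow, ← mul_assoc,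
    ← ENNReal.ofReal_mul hpi,
    show (4 * Real.pi ^ 2)⁻¹ * (4 * Real.pi ^ 2 * freqNormSq k) = freqNormSq k by field_simp]

end Lattice

/-! ## §3 The registered stub -/

section Main

/-- **Small smooth flows are linearly nondegenerate in the mean-zero class** (the lattice-coercivity form of
Temam 1979, Ch. II §1, Thm. 1.3): with `Z = ∑_{m ≠ 0} |m|⁻⁴` and `κ = 1/(Z + 1)`, a smooth divergence-free `v` on
`T³` (any mean) with `‖Δv‖₂ ≤ κν`, `ν > 0`, admits no non-zero smooth divergence-free mean-zero `w` and smooth `q`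
with `νΔw − (v·∇)w − (w·∇)v − ∇q = 0`. [folklore] -/
theorem smallFlow_not_isLinNSEigenvalue :
    ∃ κ : ℝ, 0 < κ ∧ ∀ (ν : ℝ) (v : UnitAddTorus (Fin 3) → EuclideanSpace ℝ (Fin 3)),
      0 < ν → IsSmooth v → IsDivFree v → Real.sqrt (∫ x, ‖laplacian v x‖ ^ 2) ≤ κ * ν →
      ¬ Torus.IsLinNSEigenvalue ν v 0 := by
  -- the lattice constant `Z = ∑ |m|⁻⁴` and `κ = 1/(Z+1)`
  have hZtop : (∑' m : (Fin 3 → ℤ), ENNReal.ofReal ((freqNormSq m)⁻¹) ^ 2) ≠ ∞ := tsum_inv_freqNormSq_sq_ne_top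
  obtain ⟨Z, hZ⟩ : ∃ Z : ℝ≥0∞, (∑' m : (Fin 3 → ℤ), ENNReal.ofReal ((freqNormSq m)⁻¹) ^ 2) = Z := ⟨_, rfl⟩
  rw [hZ] at hZtop
  set z : ℝ := Z.toReal with hz
  have hz0 : 0 ≤ z := ENNReal.toReal_nonneg
  have hZz : Z = ENNReal.ofReal z := (ENNReal.ofReal_toReal hZtop).symm
  refine ⟨(z + 1)⁻¹, by positivity, ?_⟩
  rintro ν v hν hv _hdiv hsmall ⟨w, hw0, hw, hdivC, hmean, q, hq, hE⟩
  have hD : (∫ x, ‖laplacian v x‖ ^ 2) ≤ ((z + 1)⁻¹ * ν) ^ 2 := (Real.sqrt_le_left (by positivity)).1 hsmall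
  -- the kernel equations with `μ = 0`
  have hE' : ∀ x, Torus.linearizedNSOperator ν v w q x = 0 := fun x => by
    have h := hE x
    rwa [zero_smul, sub_zero, Pi.zero_apply] at h
  -- the two coefficient families
  obtain ⟨a, ha⟩ : ∃ a, mFourierCoeff (complexify ∘ v) = a := ⟨_, rfl⟩
  obtain ⟨c, hc⟩ : ∃ c, mFourierCoeff w = c := ⟨_, rfl⟩
  have har : RapidDecay a := ha ▸ hv.complexify_comp.rapidDecay_mFourierCoeff
  have hcr : RapidDecay c := hc ▸ hw.rapidDecay_mFourierCoeff
  have hc0 : c 0 = 0 := hc ▸ mFourierCoeff_zero_of_hasZeroMean hmean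
  have hct : ∀ k : Fin 3 → ℤ, (∑ jj : Fin 3, ((k jj : ℤ) : ℂ) * (c k) jj) = 0 := fun k =>
    hc ▸ KolmogorovShear.kdot_mFourierCoeff_eq_zero hw hdivC k
  have hPc : ∀ k, Torus.lerayCoeff k (c k) = c k := fun k => by
    by_cases hk : k = 0
    · rw [hk, hc0, lerayCoeff_zero_vec]
    · exact lerayCoeff_of_kdot_eq_zero hk (hct k)
  -- the mean `M = â(0)` is a real vector
  have hM : conjVec (a 0) = a 0 := by
    have h := isConjSymm_mFourierCoeff hv.integrable (0 : Fin 3 → ℤ)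
    simp only [neg_zero, ha] at h
    exact h.symm
  -- the weighted unknowns `x = |k|² ĉ`, `xb = |k|² â`
  obtain ⟨x, hx⟩ : ∃ x : (Fin 3 → ℤ) → EuclideanSpace ℂ (Fin 3), x = fun k => ((freqNormSq k : ℝ) : ℂ) • c k :=
    ⟨_, rfl⟩
  obtain ⟨xb, hxb⟩ : ∃ xb : (Fin 3 → ℤ) → EuclideanSpace ℂ (Fin 3),
      xb = fun k => ((freqNormSq k : ℝ) : ℂ) • a k := ⟨_, rfl⟩
  have hcfx : ((fun mm : Fin 3 → ℤ => (((freqNormSq mm)⁻¹ : ℝ) : ℂ)) • x) = c := by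
    rw [hx]; exact cf_weight_smul hc0
  have hcfxb : ((fun mm : Fin 3 → ℤ => (((freqNormSq mm)⁻¹ : ℝ) : ℂ)) • xb) = Function.update a 0 0 := by
    rw [hxb]; exact SteadyLatticeDrift.cf_weight_smul' a
  have hnx : ∀ k, ‖x k‖ = freqNormSq k * ‖c k‖ := fun k => by
    rw [hx, norm_smul, Complex.norm_real, Real.norm_of_nonneg (freqNormSq_nonneg k)]
  -- §A the projected equations `(ν4π²|k|² + 2πi(k·M)) ĉ(k) = -(A k + B k)`
  have hEq : ∀ k : Fin 3 → ℤ,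
      ((((ν * (4 * Real.pi ^ 2 * freqNormSq k)) : ℝ) : ℂ) +
          2 * Real.pi * Complex.I * (∑ jj : Fin 3, ((k jj : ℤ) : ℂ) * (a 0) jj)) • c k =
        -(Torus.lerayCoeff k ((WithLp.toLp 2 (fun pp : Fin 3 => transportSym
            (fun jj mm => (Function.update a 0 0) mm jj) (fun mm => c mm pp) k) : EuclideanSpace ℂ (Fin 3))) +
          Torus.lerayCoeff k ((WithLp.toLp 2 (fun pp : Fin 3 => transportSym (fun jj mm => c mm jj)
            (fun mm => (Function.update a 0 0) mm pp) k) : EuclideanSpace ℂ (Fin 3)))) := by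
    intro k
    have h := leray_linearised_eq hv hw hdivC hmean hq hE' k
    rw [ha, hc, leray_split_drift har hcr hPc k, ← add_assoc, add_right_comm] at h
    rw [add_smul]
    exact eq_neg_of_add_eq_zero_left h
  -- §B the pointwise bound `4π²ν ‖x k‖ ≤ ‖A k‖ + ‖B k‖`
  have hpt : ∀ k : Fin 3 → ℤ, ENNReal.ofReal (4 * Real.pi ^ 2 * ν) * ‖x k‖ₑ ≤
      ‖Torus.lerayCoeff k ((WithLp.toLp 2 (fun pp : Fin 3 => transportSym
            (fun jj mm => (Function.update a 0 0) mm jj) (fun mm => c mm pp) k) : EuclideanSpace ℂ (Fin 3)))‖ₑ +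
        ‖Torus.lerayCoeff k ((WithLp.toLp 2 (fun pp : Fin 3 => transportSym (fun jj mm => c mm jj)
            (fun mm => (Function.update a 0 0) mm pp) k) : EuclideanSpace ℂ (Fin 3)))‖ₑ := by
    intro k
    rw [← ofReal_norm, ← ofReal_norm, ← ofReal_norm, ← ENNReal.ofReal_mul (by positivity),
      ← ENNReal.ofReal_add (norm_nonneg _) (norm_nonneg _)]
    refine ENNReal.ofReal_le_ofReal ?_
    have hre : ((((ν * (4 * Real.pi ^ 2 * freqNormSq k)) : ℝ) : ℂ) +
        2 * Real.pi * Complex.I * (∑ jj : Fin 3, ((k jj : ℤ) : ℂ) * (a 0) jj)).re =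
        ν * (4 * Real.pi ^ 2 * freqNormSq k) := by
      rw [Complex.add_re, driftCoeff_re hM k, add_zero, Complex.ofReal_re]
    have h1 := re_mul_norm_le_norm_smul ((((ν * (4 * Real.pi ^ 2 * freqNormSq k)) : ℝ) : ℂ) +
        2 * Real.pi * Complex.I * (∑ jj : Fin 3, ((k jj : ℤ) : ℂ) * (a 0) jj)) (c k)
    rw [hre, hEq k, norm_neg] at h1
    calc 4 * Real.pi ^ 2 * ν * ‖x k‖ = ν * (4 * Real.pi ^ 2 * freqNormSq k) * ‖c k‖ := by rw [hnx]; ring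
      _ ≤ _ := h1.trans (norm_add_le _ _)
  -- §C the `ℓ²` bounds of the two projected symbols
  have hA := tsum_enorm_sq_leray_nl_cf_le xb x
  have hB := tsum_enorm_sq_leray_nl_cf_le x xb
  rw [hcfx, hcfxb, hZ] at hA hB
  have hB' := hB.trans (le_of_eq (by ring :
    ENNReal.ofReal (36 * Real.pi) ^ 2 * (Z * (∑' m, ‖x m‖ₑ ^ 2) * ∑' m, ‖xb m‖ₑ ^ 2) =
      ENNReal.ofReal (36 * Real.pi) ^ 2 * (Z * (∑' m, ‖xb m‖ₑ ^ 2) * ∑' m, ‖x m‖ₑ ^ 2)))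
  have hmain := sq_mul_tsum_le_of_pointwise hpt hA hB'
  -- §D Parseval: `∑ ‖xb‖² = ‖Δv‖₂² / (4π²)²`
  have hXB : ∑' m, ‖xb m‖ₑ ^ 2 =
      ENNReal.ofReal ((4 * Real.pi ^ 2)⁻¹) ^ 2 * ENNReal.ofReal (∫ y, ‖laplacian v y‖ ^ 2) := by
    rw [hxb, ← ha]
    exact tsum_enorm_sq_weight_coeff hv
  rw [hXB] at hmain
  -- §E either `X = 0` (then `w = 0`) or cancel `X` and contradict the smallness
  by_cases hX0 : (∑' k, ‖x k‖ₑ ^ 2) = 0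
  · apply hw0
    have hxz : ∀ k, x k = 0 := fun k => by
      have h := ENNReal.tsum_eq_zero.1 hX0 k
      rwa [pow_eq_zero_iff two_ne_zero, enorm_eq_zero] at h
    refine eq_zero_of_forall_mFourierCoeff_eq_zero hw.continuous fun k => ?_
    rw [hc]
    by_cases hk : k = 0
    · rw [hk, hc0]
    · have h := hxz k
      rw [hx] at h
      have hK : ((freqNormSq k : ℝ) : ℂ) ≠ 0 := by
        exact_mod_cast ne_of_gt (lt_of_lt_of_le one_pos (one_le_freqNormSq' hk))
      exact (smul_eq_zero.1 h).resolve_left hK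
  · -- `X < ∞`: `x` decays rapidly
    have hxr : RapidDecay x := by
      refine hcr.of_norm_le_mul_pow (C := 1) (s := 1) fun k => ?_
      rw [hnx, one_mul, pow_one]
      exact mul_le_mul_of_nonneg_right (by linarith [freqNormSq_nonneg k]) (norm_nonneg _)
    have hXtop : (∑' k, ‖x k‖ₑ ^ 2) ≠ ∞ :=
      l2_tsum_enorm_sq_ne_top (⟨x, memℓp_two_of_rapidDecay hxr⟩ :
        lp (fun _ : Fin 3 → ℤ => EuclideanSpace ℂ (Fin 3)) 2)
    have h2 : ENNReal.ofReal (4 * Real.pi ^ 2 * ν) ^ 2 ≤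
        4 * ENNReal.ofReal (36 * Real.pi) ^ 2 * Z * (ENNReal.ofReal ((4 * Real.pi ^ 2)⁻¹) ^ 2 *
          ENNReal.ofReal (∫ y, ‖laplacian v y‖ ^ 2)) := by
      refine (ENNReal.mul_le_mul_iff_left hX0 hXtop).1 (hmain.trans (le_of_eq ?_))
      ring
    -- to real numbers
    have n1 : (0 : ℝ) ≤ 4 * (36 * Real.pi) ^ 2 * z := by positivity
    have n2 : (0 : ℝ) ≤ 4 * (36 * Real.pi) ^ 2 := by positivity
    have n3 : (0 : ℝ) ≤ 4 := by norm_num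
    have n4 : (0 : ℝ) ≤ (4 * Real.pi ^ 2)⁻¹ ^ 2 := by positivity
    have n5 : (0 : ℝ) ≤ 36 * Real.pi := by positivity
    have n6 : (0 : ℝ) ≤ (4 * Real.pi ^ 2)⁻¹ := by positivity
    have n7 : (0 : ℝ) ≤ 4 * Real.pi ^ 2 * ν := by positivity
    have e2 : ENNReal.ofReal (4 * (36 * Real.pi) ^ 2 * z * ((4 * Real.pi ^ 2)⁻¹ ^ 2 * ∫ y, ‖laplacian v y‖ ^ 2)) =
        4 * ENNReal.ofReal (36 * Real.pi) ^ 2 * Z * (ENNReal.ofReal ((4 * Real.pi ^ 2)⁻¹) ^ 2 *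
          ENNReal.ofReal (∫ y, ‖laplacian v y‖ ^ 2)) := by
      rw [ENNReal.ofReal_mul n1, ENNReal.ofReal_mul n2, ENNReal.ofReal_mul n3, ENNReal.ofReal_mul n4,
        ENNReal.ofReal_pow n5, ENNReal.ofReal_pow n6, hZz, ENNReal.ofReal_ofNat]
    rw [← e2, ← ENNReal.ofReal_pow n7, ENNReal.ofReal_le_ofReal_iff (by positivity)] at h2
    exact laminar_arith_contra hz0 hν hD h2

/-- **Registered stub `stub_smallFlowNondeg`** of the line `malkin-cone-group-orbits` (companion c1): small
smooth divergence-free flows (`‖Δv‖₂ ≤ κν`, any mean) have no mean-zero classical kernel of their Navier–Stokes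
linearisation (`smallFlow_not_isLinNSEigenvalue`). [folklore] -/
theorem stub_smallFlowNondeg : ∃ κ : ℝ, 0 < κ ∧ ∀ (ν : ℝ) (v : UnitAddTorus (Fin 3) → EuclideanSpace ℝ (Fin 3)), 0 < ν → IsSmooth v → IsDivFree v → Real.sqrt (∫ x, ‖laplacian v x‖ ^ 2) ≤ κ * ν → ¬ Torus.IsLinNSEigenvalue ν v 0 :=
  smallFlow_not_isLinNSEigenvalue

end Main

end Summit.AnomalousDissipation.AnomalousDissipation.Theorems.RobustLoudUpgrade.LaminarCorner

end
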